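import Mathlib
import HarnessLib
import HarnessLib.Audit
import Summits.FinalStateConjecture.Statement
import Literature.Geometry.Lorentzian.TrappedSurface
import HarnessLib.Audit.Status.Attr

/-!
Route: CriticalAncestry

# Route CriticalAncestry — a finite black-hole census for every admissible datum (small holes have
critical ancestry), census-conditioned generic settling, and settling certifies scri

It suffices to show X = A ∧ B ∧ C ∧ D. A (FINITE CENSUS, the spine card
small-holes-have-critical-ancestry made
typed): for EVERY admissible datum and every MGHD there is n such that no Cauchy slice of the MGHD
carries n+1 connected
outermost MOTSs (instances of `OutermostMOTS` with connected surface) whose enclosed regions are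
pairwise disjoint —
the number of black holes that ever coexist is a-priori bounded; the card's mechanism (zoom at
formation events of
vanishing mass, ancient-in-scale limits, impulsive-or-conical dichotomy, mass gap away from
criticality, finitely many
⇔ no cascade) is HOW A is to be proved and becomes its layer-2 split once the census vocabulary
lands. B (SETTLING UNDER
CENSUS): Christodoulou-generic admissible data all of whose MGHDs have finite census satisfy clause
(ii) of the Statement
(sub-extremal exhaustive `FinalStateDecomposition` on the self-determined exterior). C (SETTLING
CERTIFIES SCRI, card
settling-certifies-censorship): for every admissible datum, an MGHD carrying an exhaustive
decomposition has complete
𝓘⁺ in the sojourn sense. D (support): admissible data have an MGHD (Choquet-Bruhat–Geroch).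
Genericity is spent ONCE
(in B); A and C hold for all data, so the assembly is monotonicity of `IsChristodoulouGeneric` in
the predicate and pays
no conjunction tax (card genericity-is-not-closed-under-and).
Lean: `FiniteCensus ∧ ExteriorSettlesUnderCensus ∧ SettlingCertifiesScri ∧ MGHDExists`

## Assembly
Pure logic (theorem `closes`, sorry-free in Sketch.lean / glue.lean): fix X; let Q be B's predicate
and P the
Statement's. For admissible D with Q D: D gives an MGHD; for every MGHD, A gives the census, Q the
sub-extremal exhaustive
decomposition, C complete 𝓘⁺ — so P D. Hence {D ∈ 𝓓 | ¬P D} ⊆ {D ∈ 𝓓 | ¬Q D}, and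
`HasCodimAtLeastIn` is monotone in the
exceptional set: the curve B provides through a P-exceptional datum avoids the Q-exceptional set, a
fortiori the
P-exceptional one. No conjunction of generic clauses occurs.

Rationale: WHY THIS LINE. "Finitely many" is the one clause of the conjecture no convergence engine addresses,
and no settling estimate can have
constants uniform in an unknown number of holes; the spine card (arXiv:2507.07636 §II, §V.D for the
phenomenology;
Choptuik1993, AbrahamsEvans1993; AnLuk2017, Christodoulou2008 for the impulsive class;
KlainermanRodnianskiSzeftel2015
for unit-scale compactness; Perelman2002 §11–12 and KochNadirashviliSereginSverak2009 as the
template "compactness of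
rescalings → classification of ancient objects → quantum per event") is the pool's only proposed
SOURCE of an a-priori
bound, so this route files that bound as a typed, MOTS-level statement (A) over
`OutermostMOTS`/`CauchyDevelopment`
(AnderssonMetzger2009 for the objects) and makes the settling trunk CONSUME it (B), instead of
leaving finiteness to fall
out of a decomposition nobody can build without it. Imported areas:
blow-up/compactness-classification from geometric
flows (Ricci flow with surgery, Type-I Navier–Stokes) and the renormalisation-group picture of
type-II critical collapse
(GundlachMartingarcia2007), with the explicit dictionary formation event ↦ surgery, depth log(L/m) ↦
scale, critical
solution ↦ ancient κ-solution. What it does that nothing filed does: there is no FSC route at all;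
among cards, the
census here is slicing-independent and interior-blind (outermost MOTS only), A is stated for ALL
data so that it
composes with a generic B, and C removes the censorship conjunct by implication
(DafermosRodnianski2013 §2.6.2 sojourn
form; Klainerman–Nicolò far-exterior regularity as the only extra input).

RANKED CRUXES. #2 FiniteCensus (crux) — (card small-holes-have-critical-ancestry, K1∧K2∧K3 ⇒
FiniteCensus; here for ALL data) for every admissible datum D on X and every MGHD 𝒟 of D there is n
: ℕ such that for every Cauchy slice of 𝒟 — rendered as any `CauchyDevelopment 𝒟'` of any data set
D' on any connected 3-manifold X' with `𝒟'.toSpacetime = 𝒟.toSpacetime` — and every family S₀,…,Sₙ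
of `OutermostMOTS (𝓡 3) D'.h D'.k` instances with CONNECTED surface, two of the enclosed regions
(complements of the exteriors) intersect. Single connected instances are honestly outermost (an
enclosing weakly outer trapped surface in the exterior violates the instance's own test), so the
count is the number of components of the boundary of the slice's trapped region; sup over slices =
the maximal number of coexisting black holes/formation fragments, insensitive to interiors (inner
MOTSs are enclosed, Cauchy horizons lie outside the MGHD) and to mergers. [difficulty: open-problem]
(why it might fail: one smooth o₂ one-ended datum whose MGHD forms infinitely many ever smaller
holes (an infinite cascade of near-critical focusing episodes, "AF vacuum turbulence") refutes it;
the card only conjectures GENERIC absence (K3), and no theorem bounds late trapped-surface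
formation.) [arXiv:2507.07636, AnderssonMetzger2009, arXiv:0811.4721, AnLuk2017, Christodoulou2008,
KlainermanRodnianskiSzeftel2015, Choptuik1993, AbrahamsEvans1993, arXiv:2305.17171]
#3 ExteriorSettlesUnderCensus (crux) — (bridge to the settling cards:
dissipation-budget-quiet-window-capture, lasalle-bondi-lyapunov-liouville,
tangent-cone-at-timelike-infinity, final-motions-dissipative-marchal-saari; constants may now depend
on the census) for every X, the property "every MGHD 𝒟 of D with finite census (∃ n, census clause
of FiniteCensus) carries O and a C² `FinalStateDecomposition d` of O with every hole sub-extremal, O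
= exteriorOf 𝒟 d.charted and HasExhaustiveCharts d" is Christodoulou-generic (codimension ≥ 1) in
`admissibleVacuumData X` — clause (ii) of the Statement, with the census as hypothesis and
genericity spent here once. [deps: FiniteCensus] [difficulty: open-problem] (why it might fail:
contains asymptotic stability of Kerr for LARGE data and all |a|<M (known only for |a| ≪ M),
exclusion of eternal non-Kerr or non-separating end states, and generic sub-extremality (third law);
a finite census does not localise the strong field at late times by itself.) [KlainermanSzeftel2023,
GiorgiKlainermanSzeftel2022, DafermosHolzegelRodnianskiTaylor2021, DafermosLuk2017, KehleUnger2025,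
arXiv:2104.08222]
#4 SettlingCertifiesScri (crux) — (card settling-certifies-censorship, (ii) ⇒ (i) for ALL data) for
every admissible D and every MGHD 𝒟 of D: if there are O and a C² `FinalStateDecomposition d` of O
with O = exteriorOf 𝒟 d.charted and HasExhaustiveCharts d (sub-extremality not needed), then
`HasCompleteNullInfinity 𝒟` (Christodoulou's sojourn form): uniformly C²-flat complete slabs
marching to the future leave no room for a Cauchy horizon cutting off infinity; far outgoing rays
are complete by ODE comparison; far ingoing rays sojourn ≳ their starting radius in J⁺(ιB₀)
(Klainerman–Nicolò exterior region, then flat slabs / Kerr near zones). [difficulty: L] (why it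
might fail: exhaustion constrains only O = J⁺(ιX) ∩ I⁻(charted); a far EARLY singular region (rays
from X∖B₁ dying before the late charts) is invisible to (ii) and must be excluded by far-exterior
stability, printed for CK/KN fall-off, not for the Statement's o₂(r⁻¹), o₁(r⁻²) class.)
[Christodoulou1999, DafermosRodnianski2013, Dafermos2005, doi:10.1007/978-1-4612-2084-8,
arXiv:2211.15230, Bieri2010JDG]
#9 MGHDExists (support) — every admissible datum has a maximal vacuum Cauchy development over the
corrected structure `VacuumCauchyDevelopment` (Choquet-Bruhat–Geroch 1969 Thm 3; Ringström 2009 Thm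
16.6; Sbierski 2016 Thm 2.6) — the Statement's anti-vacuity conjunct; an UNPROVED NAMED FACT in tree
terms (recorded, not yet declared: CauchyProblemExistenceDefect.lean,
`choquetBruhat_geroch_exists_mghd_cauchy`), shared by every FSC route; closes from that fact plus
`PseudoRiemannianMetric.hasLeviCivita` and `isVacuumConstraintSolution_of_mem_admissibleVacuumData`
once it lands. [difficulty: M] [ChoquetBruhatGeroch1969CMP, Ringstrom2009, Sbierski2016AHP]

TWO-LAYER PLAN. FiniteCensus ⇐ (after definitions BlackHoleCensusLE / FormationEvent /
IsAncientInScaleFormation land) StaticAndBudget →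
MassGapAwayFromCriticality → NoCascade → FiniteCensus, where StaticAndBudget = card P1+P2 (finitely
many outermost-MOTS
components in the DATA, AnderssonMetzger2009; Σᵢ Mᵢ ≤ M_ADM so finitely many ⇔ mass floor),
MassGapAwayFromCriticality =
card K1+K2 (ancient-in-scale compactness at formation events of depth → ∞ + impulsive-or-conical
dichotomy ⇒ every hole
below m_*(D) is born in a near-critical episode), NoCascade = card K3 in all-data form (finitely
many near-critical
episodes per MGHD). SettlingCertifiesScri ⇐ CoverageLemma → RayComparison → SettlingCertifiesScri
(card
settling-certifies-censorship K1, K2). ExteriorSettlesUnderCensus ⇐ per-hole capture →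
separation/no-parking → exhaustive
bookkeeping, split only when a settling card's route wants it (shared trunk).

KILL CRITERIA. ¬FiniteCensus by an explicit admissible cascade datum closes the route as filed
(close refuted:FiniteCensus) and hands
the witness to threshold-lamination-vs-curve-genericity; the pivot (new route, not a repair) is
generic census + a joint
transversality crux along a common probe (genericity-is-not-closed-under-and K1).
¬SettlingCertifiesScri by a spacetime
meeting (ii) verbatim with incomplete 𝓘⁺ forces a restate with an explicit far-exterior-regularity
hypothesis (or is a
typing bug in HasExhaustiveCharts worth more than the lemma). ¬ExteriorSettlesUnderCensus (e.g. an
open set of admissible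
data with extremal or non-Kerr end states) refutes the Statement itself. A route proving clause (ii)
generically
WITHOUT the census hypothesis moots A as load-bearing (A then survives as a theorem-shaped card
target, P3 of the card).

NOT DECOMPOSED YET. Everything inside A: the census vocabulary as named definitions, formation
events and depth, ancient-in-scale limits
(needs a convergence notion for pointed vacuum developments — not in the prelude), the trichotomy
and the Liouville
statement for class (II) (card K4, optional), the mass budget Σ Mᵢ ≤ M_ADM (needs Bondi mass over
`CauchyDevelopment`;
`BondiFoliation` is still over the uninhabited `Development`). Everything inside B (it is the shared
settling trunk).
The Klainerman–Nicolò/Shen far-exterior fact C will want as `(h : Fact) →` if the o₂ class is too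
weak.

CHEAPEST FALSIFIER. (1) Re-read the axisymmetric vacuum collapse numerics (arXiv:2305.17171;
Hilditch et al., refs [289]–[291] of
arXiv:2507.07636): do the 0.05 M_ADM holes and off-axis curvature peaks track a self-similar
solution, or do small holes
form by slow thick-shell focusing (the card's "fourth class")? The latter kills the mass-gap
mechanism behind A (A itself
survives only as a bare conjecture). (2) Lean-level: exhibit, in Schwarzschild or Oppenheimer–Snyder
slices, two
CONNECTED `OutermostMOTS` instances with disjoint enclosed regions inside ONE hole (census typing
too weak) — the comparison
argument at the point of minimal area-radius says no; a counterexample is a typing repair, filed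
before anyone proves A.
Searches this session could not reach searchd/OpenAlex/S2 (rc 75 / HTTP 429); zbMATH ran (see
Novelty).

NUMBERS. Vacuum critical collapse: γ ≈ 0.36, echoing period Δ ≈ 0.6 (AbrahamsEvans1993); holes down
to ≈ 0.05 M_ADM and disjoint
horizons around separate curvature peaks, universality of the vacuum threshold "still unclear"
(arXiv:2507.07636 §V.D;
arXiv:2305.17171). Kerr stability: |a|/M ≪ 1 only (KlainermanSzeftel2023,
GiorgiKlainermanSzeftel2022). Items at open:
5 (3 cruxes, 1 support, assembly).

DEFINITION REQUESTS. BlackHoleCensusLE 𝒟 n (topic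
Summits/FinalStateConjecture/FinalStateConjecture/Theorems): the census clause of
FiniteCensus as a named predicate of a `VacuumCauchyDevelopment` and n, with the lemma that it is
monotone in n and that
single connected `OutermostMOTS` instances are pairwise either nested-intersecting or disjoint.
FormationEvent /
IsAncientInScaleFormation (same topic; card D1): first appearance of an outermost-MOTS component
along a Cauchy time
function, its depth log(L/m), and the class of pointed vacuum developments with a unit MOTS whose
causal past is
controlled and scale-invariantly non-small at every scale ≥ 1 (needs a pointed C^{1,α}/H²
convergence notion for vacuum
developments). Cite-fact wanted (already held for operator landing):
`choquetBruhat_geroch_exists_mghd_cauchy`.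

Novelty: Searches (2026-08-15): `lit search --source zbmath` "outermost marginally outer trapped surface"
(10: AMMS arXiv:0811.4721,
Eichmair arXiv:0805.4454, Carrasco–Mars arXiv:0711.1299, Alaee–Lesourd–Yau arXiv:1912.01581 …), "the
area of horizons and
the trapped region" (4: AnderssonMetzger2009 = arXiv:0708.4252, Bishop 1982, Athanasiou–Lesourd
arXiv:2009.03704),
"number of black holes bound initial data" (3, none relevant), "final state conjecture Kerr black
holes" (3:
KlainermanSzeftel polarized, Aretakis), "type II critical collapse black hole mass scaling
universality" (1, cosmology);
`lit search --source arxiv` "critical collapse gravitational waves" ≥ 2019 (7: arXiv:2305.17171,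
2303.05530, 1909.00850,
2102.09579 …); searchd / `lit galaxy search --star all` / OpenAlex / S2 unavailable this session (rc
75, queue > 90 s,
HTTP 429) — recorded in NOTES.md; the card's own battery (frontier since 2021, arXiv batteries) and
the refuter audit's
prior-art list (Perelman, KNSS, Albritton–Barker, Koike–Hara–Adachi, GundlachMartingarcia2007 §2)
are inherited.
Nearest prior art found: arXiv:2507.07636 (type-II phenomenology; no compactness formulation, no
link to the finiteness
clause); AnderssonMetzger2009 / arXiv:0811.4721 (outermost MOTS: finitely many components per slice,
jumps of MOTTs —
the per-slice statics of A, nothing uniform in time); GundlachMartingarcia2007 §2 (mass gap along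
generic ONE-PARAMETER
FAMILIES, folklore); cards superenergy-census-inverted-quantum (census on one  [refs: 0811.4721, 0805.4454, 0711.1299, 1912.01581, 0708.4252, 2009.03704, 2305.17171, 2507.07636, AnderssonMetzger2009, GundlachMartingarcia2007]

Barriers (technique_class: blowup-rescaling, critical-collapse, mots-census): - technique_class: blowup-rescaling, critical-collapse, mots-census
- Literature.Barriers.FinalStateConjecture.nakedSingularityInstability: respected — the only
all-data statements are A (a census, not censorship) and C (conditional on settling);
censorship/settling genericity sits in B with codimension-1 Christodoulou genericity, never a
universal quantifier over data.
- Literature.Barriers.FinalStateConjecture.SbierskiTrappingObstruction: not engaged by A or C (no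
decay estimate on a black-hole exterior); B inherits it in full — any prover of B must use
degenerate (trapping-respecting) Morawetz estimates; the bet is the settling cards' mechanisms, not
this route's.
- Literature.Barriers.FinalStateConjecture.SlowlyRotatingKerrFrontier: B demands the full
sub-extremal range for large data; it does not evade the frontier; the bet is that the census (A) is
what large-data arguments were missing, not that |a| ≪ M methods extend.
- Literature.Barriers.FinalStateConjecture.KerrSuperradiance: as for the two above — B's burden,
untouched by A/C.
- Literature.Barriers.FinalStateConjecture.AretakisInstability: evaded by typing — B asks C²
convergence only to SUB-extremal holes (the Statement's `Kerr.IsSubextremal`), and generic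
sub-extremality is part of B's genericity, not claimed for all data.
- Literature.Barriers.FinalStateConjecture.KehrbergerLogarithmicAsymptotics: evaded — C uses
Christodoulou's intrinsic sojourn completeness and finite-radius slabs; no conformal compactificati

History (route lifecycle, newest last):
- 2026-08-15T22:02:13Z · rev 2: restated FiniteCensus (stmt-FinalStateConjecture-10069), ExteriorSettlesUnderCensus (stmt-FinalStateConjecture-10070) — repair (route-repair unit rrefute-…-1e0ff51d): FiniteCensus stmt-10069 refuted-MISSTATED at paper level (refuter-rreview-0815T15-4-0, evidence CA_FiniteCensus_r (planner-rrefute-FinalStateConjecture-CriticalA-1e0ff51d-0)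

sub-problem: FinalStateConjecture · status: blocked · opened planner-plancard-FinalStateConjecture-FinalSt-4393d7b5-0 2026-08-15T15:06:32Z · rev 2 · ledger route-FinalStateConjecture-CriticalAncestry
GENERATED by the gate from the ledger (D-0016/17). Provers cite these decls: `theorem foo : Summit.FinalStateConjecture.FinalStateConjecture.Theses.CriticalAncestry.<Decl> := …` in Summits/FinalStateConjecture/FinalStateConjecture/Theorems/<Name>.lean.
-/

namespace Summit.FinalStateConjecture.FinalStateConjecture.Theses.CriticalAncestry

open scoped BigOperators Topology Manifold Classical MeasureTheory ProbabilityTheory Matrix InnerProductSpace ComplexConjugate ContinuousMap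
open Filter Set Function TopologicalSpace MeasureTheory

attribute [summit_statement] _root_.FinalStateConjecture

-- earlier FiniteCensus (stmt-FinalStateConjecture-10069, replaced 2026-08-15T22:02:13Z -> stmt-FinalStateConjecture-13847): retired by None — ∀ (X : Type) [TopologicalSpace X] [ChartedSpace (EuclideanSpace ℝ (Fin 3)) X] [IsManifold (𝓡 3) ((⊤ : ENat) : WithTop ENat) X] [T2Space X] [SecondCountableTopology X] [ConnectedSpace X] (D : Literature.Geometry.Lorentzian.InitialDataSet (𝓡 3) X), D ∈ Literatur
/-- item stmt-FinalStateConjecture-13847 · crux · rank 2 · open · by planner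
why it might fail: All data: one admissible datum whose MGHD forms an endless cascade of ever-smaller holes refutes it (nothing bounds late trapped-surface formation; card K3 is generic-only); sup over ALL Cauchy slices: a wild slice deep inside ONE hole might carry many non-nested trapped pockets (AMMS jumps, Siino).
sources: arXiv:2507.07636, AnderssonMetzgerTrapped2009, arXiv:0811.4721, arXiv:2303.15512, AnLuk2017, Christodoulou2008
[crux] REPAIRED FiniteCensus (stmt-10069 refuted-misstated at paper level,
refuter-rreview-0815T15-4-0 + rattack-10503 EVIDENCE.md: Literature `OutermostMOTS` admits the slit
exterior X'∖S with ν pointing away from the end, so the MITS leaves of a time-reversed An–Han/Li–Yu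
dynamical horizon lying in one Cauchy slice were n+1 connected instances with pairwise disjoint
'enclosed regions' (= the leaves) for every n). Repair C′ (the refuters' clause, verbatim, per
instance): the enclosed region ((S j).exterior)ᶜ is COMPACT with NONEMPTY INTERIOR. On a Cauchy
slice X' of the MGHD of one-ended admissible data (X' ≅ X) this says exactly: S j separates X' and
its exterior is the END side — so ν is end-ward (pointsInto), θ⁺ = tr k + H = 0 is the genuine
future-outgoing expansion (D'.k is pinned to the FUTURE normal by `DataEmbedding.isFutureUnitNormal`
and `𝒟'.toSpacetime = 𝒟.toSpacetime` fixes the time orientation, so (h,−k) is not a back door), and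
slit instances (interior ∅), inward one-sided instances (complement non-compact; also killed by tiny
spheres) and non-separating surfaces (slit forced) are all excluded; inner MOTT leaves then fail the
structure's outermost field against the o -/
@[route_item "route-FinalStateConjecture-CriticalAncestry", crux]
def FiniteCensus : Prop :=
  ∀ (X : Type) [TopologicalSpace X] [ChartedSpace (EuclideanSpace ℝ (Fin 3)) X] [IsManifold (𝓡 3) ((⊤ : ENat) : WithTop ENat) X] [T2Space X] [SecondCountableTopology X] [ConnectedSpace X] (D : Literature.Geometry.Lorentzian.InitialDataSet (𝓡 3) X), D ∈ Literature.Geometry.Lorentzian.admissibleVacuumData X → ∀ 𝒟 : Literature.Geometry.Lorentzian.VacuumCauchyDevelopment D, 𝒟.IsMaximal → ∃ n : ℕ, ∀ (X' : Type) [TopologicalSpace X'] [ChartedSpace (EuclideanSpace ℝ (Fin 3)) X'] [IsManifold (𝓡 3) ((⊤ : ENat) : WithTop ENat) X'] [ConnectedSpace X'] (D' : Literature.Geometry.Lorentzian.InitialDataSet (𝓡 3) X') (𝒟' : Literature.Geometry.Lorentzian.CauchyDevelopment D'), 𝒟'.toSpacetime = 𝒟.toSpacetime → ∀ S : Fin (n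 + 1) → Literature.Geometry.Lorentzian.OutermostMOTS (𝓡 3) D'.h D'.k, (∀ j, ConnectedSpace (S j).surf) → (∀ j, IsCompact (((S j).exterior : Set X'))ᶜ ∧ (interior (((S j).exterior : Set X'))ᶜ).Nonempty) → ∃ j j', j ≠ j' ∧ ((((S j).exterior : Set X'))ᶜ ∩ (((S j').exterior : Set X'))ᶜ).Nonempty

-- earlier ExteriorSettlesUnderCensus (stmt-FinalStateConjecture-10070, replaced 2026-08-15T22:02:13Z -> stmt-FinalStateConjecture-13848): open — ∀ (X : Type) [TopologicalSpace X] [ChartedSpace (EuclideanSpace ℝ (Fin 3)) X] [IsManifold (𝓡 3) ((⊤ : ENat) : WithTop ENat) X] [T2Space X] [SecondCountableTopology X] [ConnectedSpace X], Literature.Geometry.Lorentzian.InitialDataSet.IsChristodoulouGeneric (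
/-- item stmt-FinalStateConjecture-13848 · crux · rank 3 · open · by planner
why it might fail: Clause (ii) itself under a census hypothesis: needs Kerr asymptotic stability for LARGE data and all |a|<M (known only for |a|≪M), exclusion of eternal non-Kerr/non-separating end states, generic sub-extremality though extremal holes do form, C² charts to the horizons; a census localises nothing.
sources: KlainermanSzeftel2023, GiorgiKlainermanSzeftel2022, DafermosHolzegelRodnianskiTaylor2021, DafermosLuk2017, KehleUnger2025
[crux] RE-TYPED with FiniteCensus (same C′ in the inlined census hypothesis — per instance IsCompact
(((S j).exterior : Set X'))ᶜ ∧ (interior (((S j).exterior : Set X'))ᶜ).Nonempty — so the hypothesis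
is no longer unsatisfiable on developments containing a spacelike MITS tube, where the old item held
vacuously; refuter notes rreview-0815T15-4-0 15:48, g43-21, g43-31 on stmt-10070) (bridge to the
settling cards: dissipation-budget-quiet-window-capture, lasalle-bondi-lyapunov-liouville,
tangent-cone-at-timelike-infinity, final-motions-dissipative-marchal-saari; constants may depend on
the census) for every X, the property "every MGHD 𝒟 of D with finite C′-census (∃ n, census clause
of FiniteCensus) carries O and a C² `FinalStateDecomposition d` of O with every hole sub-extremal, O
= exteriorOf 𝒟 d.charted and HasExhaustiveCharts d" is Christodoulou-generic (codimension ≥ 1) in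
`admissibleVacuumData X` — clause (ii) of the Statement with the census as hypothesis, genericity
spent here once. This route's item only: HarmonicFluxCensus keeps stmt-10070 until its planner
re-types 10502/10503 with the same clause (identical signature ⇒ the gate re-merges the items).
[deps: FiniteCensus] [d -/
@[route_item "route-FinalStateConjecture-CriticalAncestry", crux]
def ExteriorSettlesUnderCensus : Prop :=
  ∀ (X : Type) [TopologicalSpace X] [ChartedSpace (EuclideanSpace ℝ (Fin 3)) X] [IsManifold (𝓡 3) ((⊤ : ENat) : WithTop ENat) X] [T2Space X] [SecondCountableTopology X] [ConnectedSpace X], Literature.Geometry.Lorentzian.InitialDataSet.IsChristodoulouGeneric (Literature.Geometry.Lorentzian.admissibleVacuumData X) (fun D ↦ ∀ 𝒟 : Literature.Geometry.Lorentzian.VacuumCauchyDevelopment D, 𝒟.IsMaximal → (∃ n : ℕ, ∀ (X' : Type) [TopologicalSpace X'] [ChartedSpace (EuclideanSpace ℝ (Fin 3)) X'] [IsManifold (𝓡 3) ((⊤ : ENat) : WithTop ENat) X'] [ConnectedSpace X'] (D' : Literature.Geometry.Lorentzian.InitialDataSet (𝓡 3) X') (𝒟' : Literature.Geometry.Lorentzian.CauchyDevelopment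 D'), 𝒟'.toSpacetime = 𝒟.toSpacetime → ∀ S : Fin (n + 1) → Literature.Geometry.Lorentzian.OutermostMOTS (𝓡 3) D'.h D'.k, (∀ j, ConnectedSpace (S j).surf) → (∀ j, IsCompact (((S j).exterior : Set X'))ᶜ ∧ (interior (((S j).exterior : Set X'))ᶜ).Nonempty) → ∃ j j', j ≠ j' ∧ ((((S j).exterior : Set X'))ᶜ ∩ (((S j').exterior : Set X'))ᶜ).Nonempty) → ∃ (O : Set 𝒟.carrier) (d : Literature.Geometry.Lorentzian.FinalStateDecomposition 𝒟.toSpacetime O 2), (∀ i, Literature.Geometry.Lorentzian.Kerr.IsSubextremal (d.mass i) (d.spin i)) ∧ O = Summit.FinalStateConjecture.exteriorOf 𝒟.toCauchyDevelopment d.charted ∧ Summit.FinalStateConjecture.HasExhaustiveCharts d) 1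

/-- item stmt-FinalStateConjecture-10071 · crux · rank 4 · open · by planner
why it might fail: Exhaustion constrains only O=J⁺(ιX)∩I⁻(charted), but the sojourn clause covers ALL rays from X∖B₁, which may die before τ₀ invisibly to (ii): far-exterior stability is load-bearing, printed only for CK/KN/Shen weighted multi-derivative fall-off, not the smooth o₂(r⁻¹),o₁(r⁻²) class (r^(-3-δ)sin r).
sources: Christodoulou1999, arXiv:0811.0354, arXiv:gr-qc/0403032, KlainermanNicolo2003, Shen2022, Bieri2010JDG
[crux] (card settling-certifies-censorship, (ii) ⇒ (i) for ALL data) for every admissible D and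
every MGHD 𝒟 of D: if there are O and a C² `FinalStateDecomposition d` of O with O = exteriorOf 𝒟
d.charted and HasExhaustiveCharts d (sub-extremality not needed), then `HasCompleteNullInfinity 𝒟`
(Christodoulou's sojourn form): uniformly C²-flat complete slabs marching to the future leave no
room for a Cauchy horizon cutting off infinity; far outgoing rays are complete by ODE comparison;
far ingoing rays sojourn ≳ their starting radius in J⁺(ιB₀) (Klainerman–Nicolò exterior region, then
flat slabs / Kerr near zones). [difficulty: L] -/
@[route_item "route-FinalStateConjecture-CriticalAncestry", crux]
def SettlingCertifiesScri : Prop :=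
  ∀ (X : Type) [TopologicalSpace X] [ChartedSpace (EuclideanSpace ℝ (Fin 3)) X] [IsManifold (𝓡 3) ((⊤ : ENat) : WithTop ENat) X] [T2Space X] [SecondCountableTopology X] [ConnectedSpace X] (D : Literature.Geometry.Lorentzian.InitialDataSet (𝓡 3) X), D ∈ Literature.Geometry.Lorentzian.admissibleVacuumData X → ∀ 𝒟 : Literature.Geometry.Lorentzian.VacuumCauchyDevelopment D, 𝒟.IsMaximal → (∃ (O : Set 𝒟.carrier) (d : Literature.Geometry.Lorentzian.FinalStateDecomposition 𝒟.toSpacetime O 2), O = Summit.FinalStateConjecture.exteriorOf 𝒟.toCauchyDevelopment d.charted ∧ Summit.FinalStateConjecture.HasExhaustiveCharts d) → Summit.FinalStateConjecture.HasCompleteNullInfinity 𝒟.toCauchyDevelopment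

/-- item stmt-FinalStateConjecture-10072 · support · rank 9 · open · by planner
sources: ChoquetBruhatGeroch1969CMP, Ringstrom2009, Sbierski2016AHP
[support] every admissible datum has a maximal vacuum Cauchy development over the corrected
structure `VacuumCauchyDevelopment` (Choquet-Bruhat–Geroch 1969 Thm 3; Ringström 2009 Thm 16.6;
Sbierski 2016 Thm 2.6) — the Statement's anti-vacuity conjunct; an UNPROVED NAMED FACT in tree terms
(recorded, not yet declared: CauchyProblemExistenceDefect.lean,
`choquetBruhat_geroch_exists_mghd_cauchy`), shared by every FSC route; closes from that fact plus
`PseudoRiemannianMetric.hasLeviCivita` and `isVacuumConstraintSolution_of_mem_admissibleVacuumData`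
once it lands. [difficulty: M] -/
@[route_item "route-FinalStateConjecture-CriticalAncestry", crux]
def MGHDExists : Prop :=
  ∀ (X : Type) [TopologicalSpace X] [ChartedSpace (EuclideanSpace ℝ (Fin 3)) X] [IsManifold (𝓡 3) ((⊤ : ENat) : WithTop ENat) X] [T2Space X] [SecondCountableTopology X] [ConnectedSpace X] (D : Literature.Geometry.Lorentzian.InitialDataSet (𝓡 3) X), D ∈ Literature.Geometry.Lorentzian.admissibleVacuumData X → ∃ 𝒟 : Literature.Geometry.Lorentzian.VacuumCauchyDevelopment D, 𝒟.IsMaximal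

/-- item stmt-FinalStateConjecture-10073 · assembly · rank 1 · open · by planner
sources: Christodoulou1999, DafermosLuk2017
[assembly] FiniteCensus → ExteriorSettlesUnderCensus → SettlingCertifiesScri → MGHDExists →
FinalStateConjecture. -/
@[route_item "route-FinalStateConjecture-CriticalAncestry", crux]
def Assembly : Prop :=
  FiniteCensus → ExteriorSettlesUnderCensus → SettlingCertifiesScri → MGHDExists → FinalStateConjecture

/-! D-0027 §2.1 — DECIDING THEOREM (planner-authored via `route open/edit --closes-file`; by planner-rrefute-FinalStateConjecture-CriticalA-1e0ff51d-0 2026-08-15T22:02:13Z):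
its hypotheses are this route's items and its conclusion the sub-problem Statement (glue_lint), and it elaborates with this file. -/

@[closes "route-FinalStateConjecture-CriticalAncestry"] theorem closes : FiniteCensus → ExteriorSettlesUnderCensus → SettlingCertifiesScri → MGHDExists → Assembly → _root_.FinalStateConjecture := by
  intro hA hB hC hD _ X _ _ _ _ _ _
  -- monotonicity of Christodoulou genericity in the predicate (pure logic over `HasCodimAtLeastIn`)
  have mono : ∀ {𝓓 : Set (Literature.Geometry.Lorentzian.InitialDataSet (𝓡 3) X)}
      {P Q : Literature.Geometry.Lorentzian.InitialDataSet (𝓡 3) X → Prop},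
      (∀ d ∈ 𝓓, Q d → P d) →
      Literature.Geometry.Lorentzian.InitialDataSet.IsChristodoulouGeneric 𝓓 Q 1 →
      Literature.Geometry.Lorentzian.InitialDataSet.IsChristodoulouGeneric 𝓓 P 1 := by
    intro 𝓓 P Q hQP hQ d hd
    obtain ⟨F, hF, h0, hinj, hmem, hE⟩ := hQ d ⟨hd.1, fun h ↦ hd.2 (hQP d hd.1 h)⟩
    exact ⟨F, hF, h0, hinj, hmem, fun c hc hc' ↦ hE c hc ⟨hc'.1, fun h ↦ hc'.2 (hQP _ hc'.1 h)⟩⟩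
  refine mono ?_ (hB X)
  intro D hDadm hQ
  refine ⟨hD X D hDadm, fun 𝒟 hmax ↦ ?_⟩
  obtain ⟨O, d, hsub, hO, hexh⟩ := hQ 𝒟 hmax (hA X D hDadm 𝒟 hmax)
  exact ⟨hC X D hDadm 𝒟 hmax ⟨O, d, hO, hexh⟩, O, d, hsub, hO, hexh⟩

end Summit.FinalStateConjecture.FinalStateConjecture.Theses.CriticalAncestry
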